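import Summits.QuantumFields.YangMills.Theorems.BalabanUVNodesN15PerCubeGreenCovDDictionary
import Summits.QuantumFields.YangMills.Theorems.BalabanUVNodesN15PerCubeGreenAdjointRightEntries
import Summits.QuantumFields.YangMills.Theorems.BalabanUVNodesN15TwoSpacingGluingCovariant
import Summits.QuantumFields.YangMills.Theorems.BalabanUVNodesN15FirstOrderDefect
import HarnessLib

/-!
# N15 = NE2, road (c) — PROGRAMME (PC), towards (PC-A″) «the THIRD sup-norm entry `G′(U)∇*_U` of [B9] (3.42) in per-cube gauges», V: THE DICTIONARY OF THE ADJOINT GRADIENT — the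
# component `(D_U)ᵀ∘ext_ν` IS a covariant derivative along the BACKWARD shift; its per-cube covariant shape `M_W D*_ν M_{Wᵀ} = M_{−R^W}∇⁻_ν + M_{η⁻¹(R^W − 1)}`; its scalar adjoint
# Leibniz rule; and `G(D_U)ᵀ = Σ_ν (G∘D*_ν)∘pr_ν` with the row assembly bond → site (dag-n15-c g27, n15-c∕284)

Cell `pub-ymgap`, seat `pub-ymgap-dag-n15-c` (generation g27; R134 (a), s1; HUMAN RULING D-0062).  `bears_on: R4∕N15 · K3⁸ SpineGivenEndpointR13SepCoPHV (stmt-QuantumFields-27366)`;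
filed `--kind proof --supports stmt-QuantumFields-27366 --as helper` — COUNT-NEUTRAL.  Identities + one row assembly; 0 `def`, 0 `sorry`.  Imports n15-c∕270 `…PerCubeGreenCovDDictionary`
(`covD_comp_mmulOp_transpose`; through it `cgrad_transpose_mulVec`), n15-c∕282b `…PerCubeGreenAdjointRightEntries` (site carrier, `ext_ν`), n15-c `…TwoSpacingGluingCovariant`
(`covD_comp_mulOp_scalar`), dag-n15 `…FirstOrderDefect` (`hasMaj_finset_sum`).  Nothing in the tree is modified.

WHAT.  These are the letters n15-c∕283′ (`uN_scAdj_rightInverse_loc_spec`) asks of its right factor `E`, for `E := D*_{U,ν} := covD η (x ↦ T_ν(x − e_ν)ᵀ) (· − e_ν)`: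
§1 (abstract carrier) ★ `covD_symm_eq_bgrad_add` — BACKWARD species split `covD η R e⁻¹ = M_{−R}∘∇⁻_e + M_{η⁻¹(R − 1)}` (n15-c∕270's forward twin); ★ `mmulOp_covD_mmulOp_transpose` —
`M_W∘covD η R s∘M_{Wᵀ} = covD η R^W s`, `R^W(x) = W(x)R(x)W(sx)ᵀ` (`WWᵀ = WᵀW = 1`; 270's gauge law); ★★ `covD_symm_covShape` — the per-cube COVARIANT SHAPE
`M_W∘covD η R e⁻¹∘M_{Wᵀ} = M_{−R^W}∘∇⁻_e + M_{η⁻¹(R^W − 1)}` (283′'s `hEcov` with `RE = −R^W`, `BE = η⁻¹(R^W − 1)`); ★ `mulOp_comp_covD_symm` — the scalar adjoint Leibniz rule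
`M_h∘covD η R e⁻¹ = covD η R e⁻¹∘M_{h∘e} + M_{∇⁺_e h}` (283′'s `hleib`, `dh = ∇⁺h`).  §2 (site carrier of n15-c∕260) ★★ `mulVecLin_cgradT_comp_ext_eq_covD` — `(D_T)ᵀ∘ext_ν = covD n⁻¹
(x ↦ T_ν(x − e_ν)ᵀ) (· − e_ν)` (282b's `∂ᵀ∘ext_ν = −∇⁻_ν` at a live transporter); `sum_ext_comp_proj` (`Σ_ν ext_ν∘pr_ν = 1`); ★★ `mulVecLin_mul_cgradT_eq_sum` — `G(D_T)ᵀ = Σ_ν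
(G∘D*_ν)∘pr_ν`; ★★ `hasMaj_mulVecLin_mul_cgradT` — per-component rows `G∘D*_ν ≤ Be^{−ρd}` (site → site) give `G(D_T)ᵀ ≤ (d+1)Be^{−ρd}` (bond → site).

HONEST FRAMING ∕ LIMITS.  Algebra of the covariant derivative and one row bookkeeping step; no estimate of any propagator; (3.23) p.394, (3.42) p.397, (3.50) p.400 cited for SHAPES
only.  NE2⁺ NOT PRINTED, NOT proved; N15 of record untouched; K3⁸ OPEN; counts UNMOVED.  Restate-immune (no Theses import).
-/

noncomputable section

open scoped BigOperators Matrix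
open Finset

namespace Summit.QuantumFields.YangMills.BalabanUVNodes.N15.Gluing

open Literature.MathematicalPhysics.QuantumFieldTheory.Balaban1983to89
open Literature.MathematicalPhysics.QuantumFieldTheory.Balaban1983to89.B11SectG (BlockNorm HasMaj)
open Literature.MathematicalPhysics.QuantumFieldTheory.Balaban1983to89.T4EtaRateCoeffDefect (pull pull_apply diagK hasMaj_pull)
open Literature.MathematicalPhysics.QuantumFieldTheory.Balaban1983to89.B6Prop26Gluing (mulOp mulOp_apply)
open Literature.MathematicalPhysics.QuantumFieldTheory.Balaban1983to89.B5Prop11Plancherel (Tor fine unitVec)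
open Literature.MathematicalPhysics.QuantumFieldTheory.Balaban1983to89.B6UnitTorusCarrier (unitTorusGeo)
open Literature.MathematicalPhysics.QuantumFieldTheory.King1986.Torus (blockOf)
open Summit.QuantumFields.YangMills.BalabanUVNodes.N15.MatrixSpecies (mmulOp mmulOp_apply mmulOp_comp_mmulOp liftMap liftBlk liftEquiv liftEquiv_apply liftEquiv_symm_apply covD covD_apply)
open Summit.QuantumFields.YangMills.BalabanUVNodes.N15.BackgroundLayer (fgrad fgrad_apply bgrad bgrad_apply linearMap_comp_sum)
open Summit.QuantumFields.YangMills.BalabanUVNodes.N15.DerivDefect (hasMaj_finset_sum)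
open Summit.QuantumFields.YangMills.BalabanUVNodes.N15.CovLandau (cgrad cgrad_mulVec)

/-! ## §1 The covariant derivative along the backward shift: species split, gauge conjugation, Leibniz -/

section Abstract

variable {X ι : Type} [Fintype ι] [DecidableEq ι]

/-- ★ **BACKWARD SPECIES SPLIT**: `covD η R e⁻¹ = M_{−R}∘∇⁻_e + M_{η⁻¹(R − 1)}` (`∇⁻_e` of weight `η⁻¹`; n15-c∕270 `covD_eq_fgrad_add` along the inverse shift).
[cite: Balaban1985BackgroundPropagators, (3.50) p.400, (3.23) p.394 (shape)] -/
theorem covD_symm_eq_bgrad_add (η : ℝ) (R : X → Matrix ι ι ℝ) (e : X ≃ X) :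
    covD η R ⇑e.symm = mmulOp (fun x => -R x) ∘ₗ bgrad η⁻¹ (liftEquiv e ι) + mmulOp (fun x => η⁻¹ • (R x - 1)) := by
  refine LinearMap.ext fun f => funext fun p => ?_
  obtain ⟨x, i⟩ := p
  rw [covD_apply, LinearMap.add_apply, Pi.add_apply, LinearMap.comp_apply, mmulOp_apply, mmulOp_apply]
  simp only [bgrad_apply, liftEquiv_symm_apply, Matrix.neg_apply, Matrix.smul_apply, Matrix.sub_apply, Matrix.one_apply, smul_eq_mul, mul_sub, sub_mul,
    Finset.sum_sub_distrib, mul_ite, mul_one, mul_zero, ite_mul, zero_mul, Finset.sum_ite_eq, Finset.mem_univ, if_true, Finset.mul_sum, neg_mul, Finset.sum_neg_distrib]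
  ring

/-- ★ **GAUGE CONJUGATION**: `M_W∘covD η R s∘M_{Wᵀ} = covD η R^W s`, `R^W(x) = W(x)R(x)W(sx)ᵀ`, for `WWᵀ = WᵀW = 1` (n15-c∕270's gauge law, both gauge factors moved to one side).
[cite: Balaban1985BackgroundPropagators, (3.34)–(3.35) p.396, (3.50) p.400 (shape)] -/
theorem mmulOp_covD_mmulOp_transpose {W : X → Matrix ι ι ℝ} (hW : ∀ x, W x * (W x)ᵀ = 1) (hW' : ∀ x, (W x)ᵀ * W x = 1) (η : ℝ) (R : X → Matrix ι ι ℝ) (s : X → X) :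
    mmulOp W ∘ₗ covD η R s ∘ₗ mmulOp (fun x => (W x)ᵀ) = covD η (fun x => W x * R x * (W (s x))ᵀ) s := by
  have h1 : mmulOp (fun x => W x * (W x)ᵀ) = (LinearMap.id : (X × ι → ℝ) →ₗ[ℝ] (X × ι → ℝ)) := by
    refine LinearMap.ext fun f => funext fun p => ?_
    simp [mmulOp_apply, hW, Matrix.one_apply]
  rw [covD_comp_mmulOp_transpose hW' η R s, ← LinearMap.comp_assoc, mmulOp_comp_mmulOp, h1, LinearMap.id_comp]

/-- ★★ **THE PER-CUBE COVARIANT SHAPE OF THE ADJOINT GRADIENT**: `M_W∘covD η R e⁻¹∘M_{Wᵀ} = M_{−R^W}∘∇⁻_e + M_{η⁻¹(R^W − 1)}`, `R^W(x) = W(x)R(x)W(e⁻¹x)ᵀ` — n15-c∕283′'s `hEcov` with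
`R_E = −R^W`, `B_E = η⁻¹(R^W − 1)`. [cite: Balaban1985BackgroundPropagators, (3.34)–(3.35) p.396, (3.42) p.397, (3.50) p.400 (shape)] -/
theorem covD_symm_covShape {W : X → Matrix ι ι ℝ} (hW : ∀ x, W x * (W x)ᵀ = 1) (hW' : ∀ x, (W x)ᵀ * W x = 1) (η : ℝ) (R : X → Matrix ι ι ℝ) (e : X ≃ X) :
    mmulOp W ∘ₗ covD η R ⇑e.symm ∘ₗ mmulOp (fun x => (W x)ᵀ) =
      mmulOp (fun x => -(W x * R x * (W (e.symm x))ᵀ)) ∘ₗ bgrad η⁻¹ (liftEquiv e ι) + mmulOp (fun x => η⁻¹ • (W x * R x * (W (e.symm x))ᵀ - 1)) := by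
  rw [mmulOp_covD_mmulOp_transpose hW hW']
  exact covD_symm_eq_bgrad_add η _ e

/-- ★ **SCALAR ADJOINT LEIBNIZ RULE**: `M_h∘covD η R e⁻¹ = covD η R e⁻¹∘M_{h∘e} + M_{∇⁺_e h}` (`∇⁺_e h = η⁻¹(h∘e − h)`; n15-c `covD_comp_mulOp_scalar` read from the left) — n15-c∕283′'s
`hleib` with `dh = ∇⁺_{e_ν}h`. [cite: Balaban1984PropagatorsII, (2.133)–(2.136) p.247 (transposed: shape)] -/
theorem mulOp_comp_covD_symm (η : ℝ) (R : X → Matrix ι ι ℝ) (e : X ≃ X) (h : X → ℝ) :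
    mulOp (fun p : X × ι => h p.1) ∘ₗ covD η R ⇑e.symm = covD η R ⇑e.symm ∘ₗ mulOp (fun p : X × ι => h (e p.1)) + mulOp (fun p : X × ι => fgrad η⁻¹ e h p.1) := by
  refine LinearMap.ext fun f => funext fun p => ?_
  simp only [LinearMap.add_apply, LinearMap.comp_apply, Pi.add_apply, mulOp_apply, covD_apply, fgrad_apply, Equiv.apply_symm_apply]
  have hsum : ∑ j, R p.1 p.2 j * (h p.1 * f (e.symm p.1, j)) = h p.1 * ∑ j, R p.1 p.2 j * f (e.symm p.1, j) := by
    rw [Finset.mul_sum]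
    exact Finset.sum_congr rfl fun j _ => by ring
  rw [hsum]
  ring

end Abstract

/-! ## §2 On the site carrier: `(D_T)ᵀ∘ext_ν` is a covariant derivative along `−e_ν`; `G(D_T)ᵀ = Σ_ν (G∘D*_ν)∘pr_ν`; rows bond → site -/

section Sites

variable {d : ℕ} {L : ℕ} [NeZero L] {mv kk : ℕ} {hL : Odd L ∧ 1 < L} (ι : Type) [Fintype ι] [DecidableEq ι]

/-- ★★ **`(D_T)ᵀ∘ext_ν = covD n⁻¹ (x ↦ T_ν(x − e_ν)ᵀ) (· − e_ν)`**: the transposed covariant gradient applied to a bond field living in the component `ν` is the covariant derivative of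
weight `n` along the BACKWARD shift with the TRANSPOSED transporter read at the backward bond (`cgrad_transpose_mulVec`; n15-c∕282b `mulVecLin_cgradT_comp_ext` is `T ≡ 1`).
[cite: Balaban1985BackgroundPropagators, (3.23) p.394, (3.42) p.397 (entry `G′(U)∇*_U`: shape)] -/
theorem mulVecLin_cgradT_comp_ext_eq_covD (T : Fin (d + 1) → ScX d L mv kk hL → Matrix ι ι ℝ) (ν : Fin (d + 1)) :
    Matrix.mulVecLin ((cgrad (cvM d L mv kk hL) (L ^ kk) T)ᵀ) ∘ₗ
        (mulOp (fun b : (ScX d L mv kk hL × Fin (d + 1)) × ι => if b.1.2 = ν then (1 : ℝ) else 0) ∘ₗ pull (fun b : (ScX d L mv kk hL × Fin (d + 1)) × ι => (b.1.1, b.2))) =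
      covD ((((L ^ kk : ℕ) : ℝ))⁻¹) (fun y => (T ν ((scShift d L mv kk hL ν).symm y))ᵀ) ⇑(scShift d L mv kk hL ν).symm := by
  classical
  refine LinearMap.ext fun f => funext fun p => ?_
  obtain ⟨x, i⟩ := p
  rw [LinearMap.comp_apply, Matrix.mulVecLin_apply, cgrad_transpose_mulVec, covD_apply, inv_inv,
    Finset.sum_eq_single ν (fun ν' _ hν => by simp [mulOp_apply, pull_apply, hν]) (fun h => (h (Finset.mem_univ _)).elim)]
  simp only [LinearMap.comp_apply, mulOp_apply, pull_apply, if_true, one_mul, Matrix.transpose_apply, Equiv.addRight_symm, Equiv.coe_addRight, Nat.cast_pow,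
    ← sub_eq_add_neg]

omit [NeZero L] [Fintype ι] [DecidableEq ι] in
/-- `Σ_ν ext_ν∘pr_ν = 1` on bond fields. [folklore] -/
theorem sum_ext_comp_proj :
    ∑ ν : Fin (d + 1), (mulOp (fun b : (ScX d L mv kk hL × Fin (d + 1)) × ι => if b.1.2 = ν then (1 : ℝ) else 0) ∘ₗ
        pull (fun b : (ScX d L mv kk hL × Fin (d + 1)) × ι => (b.1.1, b.2))) ∘ₗ pull (fun p : ScX d L mv kk hL × ι => ((p.1, ν), p.2)) =
      (LinearMap.id : ((ScX d L mv kk hL × Fin (d + 1)) × ι → ℝ) →ₗ[ℝ] ((ScX d L mv kk hL × Fin (d + 1)) × ι → ℝ)) := by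
  classical
  refine LinearMap.ext fun F => funext fun b => ?_
  obtain ⟨⟨x, μ⟩, i⟩ := b
  simp only [LinearMap.sum_apply, Finset.sum_apply, LinearMap.comp_apply, mulOp_apply, pull_apply, LinearMap.id_apply, ite_mul, one_mul, zero_mul,
    Finset.sum_ite_eq, Finset.mem_univ, if_true]

/-- ★★ **`G(D_T)ᵀ = Σ_ν (G∘D*_ν)∘pr_ν`**: a site operator after the transposed covariant gradient, component by component. [cite: Balaban1985BackgroundPropagators, Thm 3.1 (3.42) p.397 (entry `G′(U)∇*_U`: shape)] -/
theorem mulVecLin_mul_cgradT_eq_sum (G : Matrix (ScX d L mv kk hL × ι) (ScX d L mv kk hL × ι) ℝ) (T : Fin (d + 1) → ScX d L mv kk hL → Matrix ι ι ℝ) :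
    Matrix.mulVecLin (G * (cgrad (cvM d L mv kk hL) (L ^ kk) T)ᵀ) =
      ∑ ν : Fin (d + 1), (Matrix.mulVecLin G ∘ₗ covD ((((L ^ kk : ℕ) : ℝ))⁻¹) (fun y => (T ν ((scShift d L mv kk hL ν).symm y))ᵀ) ⇑(scShift d L mv kk hL ν).symm) ∘ₗ
        pull (fun p : ScX d L mv kk hL × ι => ((p.1, ν), p.2)) := by
  rw [Matrix.mulVecLin_mul, ← LinearMap.comp_id (Matrix.mulVecLin G ∘ₗ Matrix.mulVecLin ((cgrad (cvM d L mv kk hL) (L ^ kk) T)ᵀ)), ← sum_ext_comp_proj (hL := hL) ι,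
    linearMap_comp_sum]
  refine Finset.sum_congr rfl fun ν _ => ?_
  rw [← mulVecLin_cgradT_comp_ext_eq_covD ι T ν]
  simp only [LinearMap.comp_assoc]

/-- ★★ **ROWS BOND → SITE FROM THE COMPONENTS**: if every `G∘D*_ν ≤ B·e^{−ρ|y−y′|}` (site → site) then `G(D_T)ᵀ ≤ (d+1)B·e^{−ρ|y−y′|}` (bond → site; `pr_ν ≤ diag 1`).
[cite: Balaban1985BackgroundPropagators, Thm 3.1 (3.42) p.397 (entry `G′(U)∇*_U`: shape); Balaban1984PropagatorsII, p.232 («A summation preserves it also»)] -/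
theorem hasMaj_mulVecLin_mul_cgradT {G : Matrix (ScX d L mv kk hL × ι) (ScX d L mv kk hL × ι) ℝ} {T : Fin (d + 1) → ScX d L mv kk hL → Matrix ι ι ℝ} {B ρ : ℝ} (hB : 0 ≤ B)
    (h : ∀ ν, HasMaj (ScNorm d L mv kk hL ι) (ScNorm d L mv kk hL ι)
      (Matrix.mulVecLin G ∘ₗ covD ((((L ^ kk : ℕ) : ℝ))⁻¹) (fun y => (T ν ((scShift d L mv kk hL ν).symm y))ᵀ) ⇑(scShift d L mv kk hL ν).symm)
      (fun y y' => B * Real.exp (-(ρ * (unitTorusGeo L kk (cvM d L mv kk hL)).dist y y')))) :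
    HasMaj (BlockNorm.ofBlocks (unitTorusGeo L kk (cvM d L mv kk hL)) (liftBlk (fun b : ScX d L mv kk hL × Fin (d + 1) => blockOf (L ^ kk) (cvM d L mv kk hL) b.1) ι)) (ScNorm d L mv kk hL ι)
      (Matrix.mulVecLin (G * (cgrad (cvM d L mv kk hL) (L ^ kk) T)ᵀ)) (fun y y' => ((d : ℝ) + 1) * B * Real.exp (-(ρ * (unitTorusGeo L kk (cvM d L mv kk hL)).dist y y'))) := by
  rw [mulVecLin_mul_cgradT_eq_sum ι G T]
  have hν : ∀ ν : Fin (d + 1), HasMaj (BlockNorm.ofBlocks (unitTorusGeo L kk (cvM d L mv kk hL)) (liftBlk (fun b : ScX d L mv kk hL × Fin (d + 1) => blockOf (L ^ kk) (cvM d L mv kk hL) b.1) ι))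
      (ScNorm d L mv kk hL ι)
      ((Matrix.mulVecLin G ∘ₗ covD ((((L ^ kk : ℕ) : ℝ))⁻¹) (fun y => (T ν ((scShift d L mv kk hL ν).symm y))ᵀ) ⇑(scShift d L mv kk hL ν).symm) ∘ₗ
        pull (fun p : ScX d L mv kk hL × ι => ((p.1, ν), p.2)))
      (fun y y' => B * Real.exp (-(ρ * (unitTorusGeo L kk (cvM d L mv kk hL)).dist y y')) * (1 : ℝ)) := fun ν =>
    hasMaj_comp_diag _ (fun y y' => mul_nonneg hB (Real.exp_nonneg _)) (h ν)
      (hasMaj_pull (g := unitTorusGeo L kk (cvM d L mv kk hL)) (liftBlk (fun b : ScX d L mv kk hL × Fin (d + 1) => blockOf (L ^ kk) (cvM d L mv kk hL) b.1) ι)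
        (fun p : ScX d L mv kk hL × ι => ((p.1, ν), p.2)))
  refine (hasMaj_finset_sum Finset.univ fun ν _ => hν ν).mono fun y y' => le_of_eq ?_
  rw [Finset.sum_const, Finset.card_univ, Fintype.card_fin, nsmul_eq_mul, Nat.cast_add, Nat.cast_one]
  ring

end Sites

end Summit.QuantumFields.YangMills.BalabanUVNodes.N15.Gluing

end
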